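import Summits.Langlands.Langlands.Statement
import Literature.NumberTheory.Automorphic.CarayolCompatibilityOfLocalGlobalProofs
import Literature.NumberTheory.Automorphic.LocalComponentBJGenericProofs
import Literature.NumberTheory.Automorphic.LocalComponentBJSatakeProofs
import HarnessLib

/-!
# Line `Sketch` for the crux `ReciprocityUpToIrreducibility` (item stmt-Langlands-14328), continuation c5:
# stub C2 — rank two, `v ∤ ℓ`: local–global compatibility at an unramified place of `π` forces
# Satake–Frobenius compatibility

Support file (closes nothing; registered stub `stub_rankTwo_satake_of_localGlobal_away` of the checked
skeleton `Lines/Sketch.lean`, wave 3 of continuation lead c5).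

For a cuspidal `π` on `GL₂(𝔸_K)` unramified at a finite place `v ∤ ℓ`, a framed
`ρ : Γ_K → GL₂(ℚ̄_ℓ)`, `ι : ℚ̄_ℓ ≃ ℂ` and ANY reciprocity data `Rec`, the summit's local–global clause
`LocalGlobalCompatibleAt Rec ι π ρ v` (a local component `π_v`, the Grothendieck–Deligne recipe `r` of
`ρ|_{W_{K_v}}`, its transport `rℂ = ι(r)` and `rℂ^{F-ss} ∈ rec_v(π_v)`) implies the Satake clause
`SatakeFrobCompatibleAt ι π ρ v`: `ρ` is unramified at `v` and every arithmetic Frobenius at `v` has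
characteristic polynomial `arithFrobPolyOfSatake ι q_v 1 α` for a Satake parameter `α` of `π` at `v`.
This is the argument of the tree's `Carayol1986_unramifiedCompatibility.compatible_of_localGlobal`
(`CarayolCompatibilityOfLocalGlobalProofs`) in the `L`-normalisation (no half twist): genericity of the
cuspidal local component (`CuspidalAutomorphicRepData.exists_isGeneric_of_hasLocalComponentAt`), the
Satake dictionary (`CuspidalAutomorphicRepData.isSatakeParameter_of_hasLocalComponentAt`), the local
deduction `WeilDeligneRep.unramified_of_hasFrobSemisimpleClass_recGL_of_isSatakeParameter` and the bridge
`FramedGaloisRep.isUnramifiedAt_and_hasFrobCharpolyAt_of_weilDeligne`.  No definitions; std axioms.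
-/

noncomputable section

set_option linter.dupNamespace false -- project-wide option (lakefile weak.linter.dupNamespace); `Summit.Langlands.Langlands` is the mandated namespace

open scoped MatrixGroups Matrix NumberField Classical Polynomial
open Filter IsDedekindDomain Field Polynomial
open Literature.NumberTheory.Automorphic Literature.NumberTheory.GaloisRepresentations
open Literature.NumberTheory.PAdicHodge
open Summit.Langlands

namespace Summit.Langlands.Langlands.Theorems.ReciprocityUpToIrreducibility

section RankTwoConverseAway

variable {K : Type} [Field K] [NumberField K] {ℓ : ℕ} [Fact ℓ.Prime]

/-- **Rank two, `v ∤ ℓ`: local–global compatibility at an unramified place of `π` implies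
Satake–Frobenius compatibility, for EVERY `Rec`.**  Unpack the clause (`π_v`, `r`, `rℂ`,
Grothendieck–Deligne `IsWeilDeligneOfLadic` at `v ∤ ℓ`, transport, class `rec_v(π_v)`); `π_v` is
generic (`exists_isGeneric_of_hasLocalComponentAt`) and has the Satake parameter `α = {x₀, x₁}` of `π`
at `v` for a uniformiser `ϖ` (`isSatakeParameter_of_hasLocalComponentAt`, Flath); the Carayol local
deduction (`WeilDeligneRep.unramified_of_hasFrobSemisimpleClass_recGL_of_isSatakeParameter`) gives
`rℂ.N = 0`, `rℂ` unramified, `det(1 - T rℂ(Φ)) = 1 - e₁(x) T + e₂(x) T²`, `e₂(x) ≠ 0`; the bridge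
`FramedGaloisRep.isUnramifiedAt_and_hasFrobCharpolyAt_of_weilDeligne` returns `ρ` unramified at `v`
with `char(Frob_v^{arith}) = arithFrobPolyOfSatake ι q_v 1 α`. [cite: CarayolASENS1986, Thm. (A)]
[cite: TateCorvallis1979, (4.2.1)] [cite: HarrisTaylorAMS2001, Thm. A (ii), (v)] -/
theorem rankTwo_satakeFrobCompatibleAt_of_localGlobalCompatibleAt_away
    {hcpt : isCompact_glFiniteIntegralLevel 2 K} (Rec : ReciprocityData K) (ι : PadicAlgCl ℓ ≃+* ℂ)
    (π : CuspidalAutomorphicRepData 2 K hcpt) (ρ : FramedGaloisRep K (PadicAlgCl ℓ) 2)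
    (v : HeightOneSpectrum (𝓞 K)) (hv : ((ℓ : ℕ) : 𝓞 K) ∉ v.asIdeal) (hπ : π.1.IsUnramifiedAt v)
    (hLG : LocalGlobalCompatibleAt Rec ι π.1 ρ v) : SatakeFrobCompatibleAt ι π.1 ρ v := by
  classical
  obtain ⟨α, hα⟩ := hπ
  obtain ⟨πv, rv, rℂ, hloc, hWD, -, hTr, hcl⟩ := hLG
  haveI := πv.isIrreducible
  -- `π_v` is generic and has the Satake parameter `α`
  obtain ⟨ψ, hψ, hgen⟩ := π.exists_isGeneric_of_hasLocalComponentAt v πv.ρ πv.isSmooth hloc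
  obtain ⟨ϖ, hϖ⟩ :=
    Valuation.exists_isUniformizer_of_isCyclic_of_nontrivial (ValuativeRel.valuation (v.adicCompletion K))
  set ϖu : (v.adicCompletion K)ˣ := Units.mk0 (ϖ : v.adicCompletion K) hϖ.ne_zero with hϖu
  have hϖu' : IsUniformizingElement ((ϖu : (v.adicCompletion K)ˣ) : v.adicCompletion K) :=
    isUniformizingElement_of_isUniformizer hϖ
  have hsat := π.isSatakeParameter_of_hasLocalComponentAt v πv.ρ πv.isSmooth hloc hα (ϖ' := ϖu) hϖ
  obtain ⟨x, hx⟩ := exists_univ_val_map_eq (R := ℂ) hsat.1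
  rw [← hx] at hsat
  -- the local deduction and the bridge back to `ρ`
  obtain ⟨he2, hN, hur, hch⟩ :=
    WeilDeligneRep.unramified_of_hasFrobSemisimpleClass_recGL_of_isSatakeParameter (Rec.llc v) πv hψ hgen
      hϖu' hsat hcl
  obtain ⟨hunr, hchar⟩ := FramedGaloisRep.isUnramifiedAt_and_hasFrobCharpolyAt_of_weilDeligne ι ρ v
    (hWD hv) hTr (Rec.llc v).hex hN hur he2 hch
  refine ⟨α, hα, hunr, ?_⟩
  rwa [hx] at hchar

/-- **Registered stub `stub_rankTwo_satake_of_localGlobal_away` (C2) of line `Sketch` (crux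
stmt-Langlands-14328), closed form of `rankTwo_satakeFrobCompatibleAt_of_localGlobalCompatibleAt_away`**:
for `GL₂`, every `Rec`, every finite `v ∤ ℓ` at which the cuspidal `π` is unramified, the summit's
local–global clause `LocalGlobalCompatibleAt Rec ι π ρ v` implies the Satake clause
`SatakeFrobCompatibleAt ι π ρ v` (Carayol's local deduction + the Grothendieck–Deligne bridge).
[cite: CarayolASENS1986, Thm. (A)] [cite: TateCorvallis1979, (4.2.1)]
[cite: HarrisTaylorAMS2001, Thm. A (ii), (v)] -/
theorem stub_rankTwo_satake_of_localGlobal_away :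
    ∀ (K : Type) [Field K] [NumberField K] (ℓ : ℕ) [Fact ℓ.Prime] (hcpt : isCompact_glFiniteIntegralLevel 2 K)
      (Rec : ReciprocityData K) (ι : PadicAlgCl ℓ ≃+* ℂ) (π : CuspidalAutomorphicRepData 2 K hcpt)
      (ρ : FramedGaloisRep K (PadicAlgCl ℓ) 2) (v : HeightOneSpectrum (𝓞 K)),
      ((ℓ : ℕ) : 𝓞 K) ∉ v.asIdeal → π.1.IsUnramifiedAt v →
      LocalGlobalCompatibleAt Rec ι π.1 ρ v → SatakeFrobCompatibleAt ι π.1 ρ v :=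
  fun _ _ _ _ _ _ Rec ι π ρ v hv hπ hLG =>
    rankTwo_satakeFrobCompatibleAt_of_localGlobalCompatibleAt_away Rec ι π ρ v hv hπ hLG

end RankTwoConverseAway

end Summit.Langlands.Langlands.Theorems.ReciprocityUpToIrreducibility

end
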